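import Mathlib
import Literature.Topology.FourManifolds.LefschetzHandlebody
import Literature.GroupTheory.CombinatorialGroupTheory.SignedHurwitzStabilisation
import Literature.GroupTheory.CombinatorialGroupTheory.SignedHurwitzExchange
import HarnessLib

/-!
# The natural stabilisation block and its two Hurwitz moves to `stabBlock` (N3 bookkeeping)
(wave 6, brick G5-1 of stub `stub_STgeo` = node N3 "one front stabilisation pair as a rebuild over
`Base (g+1)`" of NF4 `stub_modelsOnFibred_of_reach`, line `modp-braid-orbits`, crux
`ConvexBisection.AcyclicBisectionExists`, item stmt-SmoothPoincare4-10508; registered sub-goal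
`helper_hurwitzSteps_natBlock_stabBlock`; design file `work/design/N3_Stabilisation_Design.lean`)

The registered N3 statement inserts the block `stabBlock g c = (a,+)(b,+)(b,−)(a,−)`,
`a = newE g + embed g c`, `b = newF g` (Baykur 2006, Lemma 1 and §5 p. 13) in front of the embedded
old word.  The N3 design of wave 6 (G5) builds the stabilised fibred model by the Etnyre–Fuller
two-sided argument (Etnyre–Fuller 2006, §2 p. 5: two cancelling pairs on the handlebody side, two on
the cap side, then the cap's two Lefschetz handles traded to the handlebody side as their Kosinski
duals pushed off the belt INTO THE ADJACENT PAGE).  That geometry produces the NATURAL block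

  `natBlock = (a,+)(a,−)(b,+)(b,−)`

(each dual lands next to its partner), and the registered block is then reached by exactly TWO
signed Hurwitz moves at genus `g + 1` (second disjunct of `HurwitzStep` both times):

  `(a,+)(a,−)(b,+)(b,−) ↝ (a,+)(b,+)(a+b,−)(b,−) ↝ (a,+)(b,+)(b,−)(a,−)`,

using `ω(b, a) = −1`, `ω(b, a + b) = −1` (`ω = stdSymp ℤ (g+1)`, `ω(newE, newF) = 1`).  By the
landed (HS) reduction (`hurwitzStep_of_redecomposition`, p134969, with `helper_belt_pageClause`) this
turns the natural stabilisation into the registered one; the present file is the algebra: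

* §1 the pairings of the block classes; §2 the two moves (`hurwitzStep_natBlock_mid`,
  `hurwitzStep_mid_stabBlock`), the orbit, and the registered `helper_hurwitzSteps_natBlock_stabBlock`;
* §3 bookkeeping of the stabilised word `stabBlock g c ++ mapWord (embed g) l` (length `n + 4`,
  letters at positions `< 4` and `k + 4`), used by the link clauses of the rebuilt handlebody;
* §4 the block classes are primitive (`isPrimitive_newF`, `isPrimitive_newE_add_embed`) and `embed`
  preserves primitivity (`isPrimitive_embed_iff`) — the inputs of N3a (`node_STcurve`) in genus
  `g + 1`.

Everything is proved; no definitions, no named facts, no `sorry`.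
References: R. İ. Baykur, *Kähler decomposition of 4-manifolds*, AGT 6 (2006), Lemma 1, §5
[Baykur2006]; J. B. Etnyre, T. Fuller, IMRN 2006, §2 [EtnyreFuller2006]; R. E. Gompf,
A. I. Stipsicz, *4-Manifolds and Kirby Calculus* (1999), §8.2 [GompfStipsicz1999].
-/

noncomputable section

-- the prescribed namespace `Summit.<P>.<Sub>.…` duplicates `SmoothPoincare4` (P = Sub)
set_option linter.dupNamespace false

open scoped Manifold ContDiff Topology

namespace Summit.SmoothPoincare4.SmoothPoincare4.Theorems.AcyclicBisectionExists.ModpBraidOrbits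

open Literature.GroupTheory.CombinatorialGroupTheory.SignedHurwitz
open Literature.Topology.FourManifolds Literature.Topology.FourManifolds.LefschetzBase

namespace StabBlockMoves

variable {g : ℕ}

/-! ## §1 Pairings of the block classes `a = e + embed c`, `b = f` -/

/-- `ω(f, e + embed c) = -1`. [folklore] -/
theorem stdSymp_newF_blockE (c : Fin g ⊕ Fin g → ℤ) :
    stdSymp ℤ (g + 1) (newF g) (newE g + embed g c) = -1 := by
  rw [map_add, stdSymp_newF_newE, stdSymp_newF_embed, add_zero]

/-- `ω(e + embed c, f) = 1`. [folklore] -/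
theorem stdSymp_blockE_newF (c : Fin g ⊕ Fin g → ℤ) :
    stdSymp ℤ (g + 1) (newE g + embed g c) (newF g) = 1 := by
  rw [map_add, LinearMap.add_apply, stdSymp_newE_newF, stdSymp_embed_newF, add_zero]

/-- `ω(f, (e + embed c) + f) = -1`. [folklore] -/
theorem stdSymp_newF_blockE_add_newF (c : Fin g ⊕ Fin g → ℤ) :
    stdSymp ℤ (g + 1) (newF g) (newE g + embed g c + newF g) = -1 := by
  rw [map_add, stdSymp_newF_blockE, stdSymp_newF_newF, add_zero]

/-! ## §2 The two signed Hurwitz moves from the natural block to `stabBlock` -/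

/-- **First move** (second disjunct of `HurwitzStep` on the pair `(a,−), (b,+)`):
`pre ++ (a,+)(a,−)(b,+)(b,−) ++ rest ↝ pre ++ (a,+)(b,+)(a+b,−)(b,−) ++ rest`, because
`a − (ω(b, a)) • b = a + b`. [cite: GompfStipsicz1999, §8.2] -/
theorem hurwitzStep_natBlock_mid (c : Fin g ⊕ Fin g → ℤ) (pre rest : IntWord (g + 1)) :
    HurwitzStep (stdSymp ℤ (g + 1))
      (pre ++ ((newE g + embed g c, true) :: (newE g + embed g c, false) :: (newF g, true) ::
        (newF g, false) :: rest))
      (pre ++ ((newE g + embed g c, true) :: (newF g, true) ::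
        (newE g + embed g c + newF g, false) :: (newF g, false) :: rest)) := by
  refine ⟨pre ++ [(newE g + embed g c, true)], (newF g, false) :: rest,
    (newE g + embed g c, false), (newF g, true),
    by simp only [List.append_assoc, List.cons_append, List.nil_append], Or.inr ?_⟩
  simp only [List.append_assoc, List.cons_append, List.nil_append, sgn_true, one_mul,
    stdSymp_newF_blockE, neg_smul, one_smul, sub_neg_eq_add]

/-- **Second move** (second disjunct on the pair `(a+b,−), (b,−)`):
`pre ++ (a,+)(b,+)(a+b,−)(b,−) ++ rest ↝ pre ++ (a,+)(b,+)(b,−)(a,−) ++ rest`, because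
`(a + b) − (−ω(b, a+b)) • b = a`. [cite: GompfStipsicz1999, §8.2] -/
theorem hurwitzStep_mid_stabBlock (c : Fin g ⊕ Fin g → ℤ) (pre rest : IntWord (g + 1)) :
    HurwitzStep (stdSymp ℤ (g + 1))
      (pre ++ ((newE g + embed g c, true) :: (newF g, true) ::
        (newE g + embed g c + newF g, false) :: (newF g, false) :: rest))
      (pre ++ (stabBlock g c ++ rest)) := by
  refine ⟨pre ++ [(newE g + embed g c, true), (newF g, true)], rest,
    (newE g + embed g c + newF g, false), (newF g, false),
    by simp only [List.append_assoc, List.cons_append, List.nil_append], Or.inr ?_⟩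
  simp only [stabBlock, List.append_assoc, List.cons_append, List.nil_append, sgn_false, neg_mul,
    one_mul, stdSymp_newF_blockE_add_newF, neg_neg, one_smul, add_sub_cancel_right]

/-- **The natural block reaches `stabBlock` by two signed Hurwitz moves** (any prefix, any suffix).
[cite: Baykur2006, Lemma 1] -/
theorem hurwitzOrbit_natBlock_stabBlock (c : Fin g ⊕ Fin g → ℤ) (pre rest : IntWord (g + 1)) :
    HurwitzOrbit (stdSymp ℤ (g + 1))
      (pre ++ ((newE g + embed g c, true) :: (newE g + embed g c, false) :: (newF g, true) ::
        (newF g, false) :: rest))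
      (pre ++ (stabBlock g c ++ rest)) :=
  (hurwitzStep_natBlock_mid c pre rest).orbit.trans (hurwitzStep_mid_stabBlock c pre rest).orbit

/-- The FRONT case with the embedded old word as suffix: the natural front stabilisation
`natBlock ++ embed l` is two Hurwitz moves away from the registered `stabBlock g c ++ embed l`.
[cite: Baykur2006, Lemma 1] -/
theorem hurwitzSteps_natBlock_stabBlock_front (c : Fin g ⊕ Fin g → ℤ) (l : IntWord g) :
    ∃ l₁ : IntWord (g + 1),
      HurwitzStep (stdSymp ℤ (g + 1))
        ((newE g + embed g c, true) :: (newE g + embed g c, false) :: (newF g, true) ::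
          (newF g, false) :: mapWord (embed g) l) l₁ ∧
      HurwitzStep (stdSymp ℤ (g + 1)) l₁ (stabBlock g c ++ mapWord (embed g) l) :=
  ⟨_, by simpa using hurwitzStep_natBlock_mid c [] (mapWord (embed g) l),
    by simpa using hurwitzStep_mid_stabBlock c [] (mapWord (embed g) l)⟩

/-! ## §3 Bookkeeping of the stabilised word `stabBlock g c ++ mapWord (embed g) l` -/

/-- The block has four letters. [folklore] -/
@[simp] theorem length_stabBlock (c : Fin g ⊕ Fin g → ℤ) : (stabBlock g c).length = 4 := rfl

/-- The stabilised word has `n + 4` letters. [folklore] -/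
theorem length_stabBlock_append (c : Fin g ⊕ Fin g → ℤ) (l : IntWord g) :
    (stabBlock g c ++ mapWord (embed g) l).length = l.length + 4 := by
  rw [List.length_append, length_stabBlock, length_mapWord, add_comm]

/-- Letter `0` of the stabilised word is `(e + embed c, +)`. [folklore] -/
theorem getElem_stabBlock_append_zero (c : Fin g ⊕ Fin g → ℤ) (l : IntWord g)
    (h : 0 < (stabBlock g c ++ mapWord (embed g) l).length) :
    (stabBlock g c ++ mapWord (embed g) l)[0]'h = (newE g + embed g c, true) := rfl

/-- Letter `1` of the stabilised word is `(f, +)`. [folklore] -/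
theorem getElem_stabBlock_append_one (c : Fin g ⊕ Fin g → ℤ) (l : IntWord g)
    (h : 1 < (stabBlock g c ++ mapWord (embed g) l).length) :
    (stabBlock g c ++ mapWord (embed g) l)[1]'h = (newF g, true) := rfl

/-- Letter `2` of the stabilised word is `(f, −)`. [folklore] -/
theorem getElem_stabBlock_append_two (c : Fin g ⊕ Fin g → ℤ) (l : IntWord g)
    (h : 2 < (stabBlock g c ++ mapWord (embed g) l).length) :
    (stabBlock g c ++ mapWord (embed g) l)[2]'h = (newF g, false) := rfl

/-- Letter `3` of the stabilised word is `(e + embed c, −)`. [folklore] -/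
theorem getElem_stabBlock_append_three (c : Fin g ⊕ Fin g → ℤ) (l : IntWord g)
    (h : 3 < (stabBlock g c ++ mapWord (embed g) l).length) :
    (stabBlock g c ++ mapWord (embed g) l)[3]'h = (newE g + embed g c, false) := rfl

/-- The `k`-th letter of `mapWord φ l` is the `k`-th letter of `l` with its class pushed
through `φ`. [folklore] -/
theorem getElem_mapWord {V W : Type*} (φ : V → W) (l : List (V × Bool)) (k : ℕ)
    (h : k < (mapWord φ l).length) :
    (mapWord φ l)[k]'h = (φ (l[k]'(by rwa [length_mapWord] at h)).1,
      (l[k]'(by rwa [length_mapWord] at h)).2) := by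
  simp [mapWord]

/-- Letter `k + 4` of the stabilised word is the embedded `k`-th old letter (same sign).
[folklore] -/
theorem getElem_stabBlock_append_add_four (c : Fin g ⊕ Fin g → ℤ) (l : IntWord g) (k : ℕ)
    (hk : k < l.length) (h : k + 4 < (stabBlock g c ++ mapWord (embed g) l).length) :
    (stabBlock g c ++ mapWord (embed g) l)[k + 4]'h = (embed g (l[k]'hk).1, (l[k]'hk).2) := by
  rw [List.getElem_append_right (by simp)]
  simp only [length_stabBlock, Nat.add_sub_cancel]
  exact getElem_mapWord (embed g) l k _

/-- A position `i < n + 4` of the stabilised word is either one of the four block positions or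
`k + 4` for a unique old position `k < n`. [folklore] -/
theorem lt_four_or_exists_eq_add_four {n i : ℕ} (hi : i < n + 4) :
    i < 4 ∨ ∃ k, k < n ∧ i = k + 4 := by
  rcases lt_or_ge i 4 with h | h
  · exact Or.inl h
  · exact Or.inr ⟨i - 4, by omega, by omega⟩

/-- The sign of letter `k + 4` of the stabilised word is the sign of the old letter `k`.
[folklore] -/
theorem getElem_stabBlock_append_add_four_snd (c : Fin g ⊕ Fin g → ℤ) (l : IntWord g) (k : ℕ)
    (hk : k < l.length) (h : k + 4 < (stabBlock g c ++ mapWord (embed g) l).length) :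
    ((stabBlock g c ++ mapWord (embed g) l)[k + 4]'h).2 = (l[k]'hk).2 := by
  rw [getElem_stabBlock_append_add_four c l k hk h]

/-- The class of letter `k + 4` of the stabilised word is `embed` of the old class `k`.
[folklore] -/
theorem getElem_stabBlock_append_add_four_fst (c : Fin g ⊕ Fin g → ℤ) (l : IntWord g) (k : ℕ)
    (hk : k < l.length) (h : k + 4 < (stabBlock g c ++ mapWord (embed g) l).length) :
    ((stabBlock g c ++ mapWord (embed g) l)[k + 4]'h).1 = embed g (l[k]'hk).1 := by
  rw [getElem_stabBlock_append_add_four c l k hk h]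

/-! ## §4 The block classes are primitive; `embed` preserves primitivity -/

/-- An integer vector with a coordinate equal to `-1` is primitive. [folklore] -/
theorem isPrimitive_of_apply_eq_neg_one {ι : Type*} {v : ι → ℤ} {k : ι} (h : v k = -1) :
    IsPrimitive v := by
  intro d hd
  have h1 : d ∣ (1 : ℤ) := by
    have := hd k
    rw [h] at this
    exact (dvd_neg.1 this)
  exact isUnit_of_dvd_one h1

/-- `f = newF g` is primitive (its new `inr` coordinate is `1`). [folklore] -/
theorem isPrimitive_newF : IsPrimitive (newF g) :=
  isPrimitive_of_apply_eq_one (k := Sum.inr (Fin.last g)) (by simp [newF])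

/-- `e + embed c` is primitive for EVERY `c` (its new `inl` coordinate is `1`). [folklore] -/
theorem isPrimitive_newE_add_embed (c : Fin g ⊕ Fin g → ℤ) : IsPrimitive (newE g + embed g c) :=
  isPrimitive_of_apply_eq_one (k := Sum.inl (Fin.last g)) (by simp [newE])

/-- The zero vector is not primitive (every integer divides its coordinates). [folklore] -/
theorem not_isPrimitive_zero {ι : Type*} : ¬ IsPrimitive (0 : ι → ℤ) := fun h => by
  have := h 2 (fun _ => by simp)
  exact (Int.isUnit_iff.1 this).elim (by decide) (by decide)

/-- **`embed` preserves and reflects primitivity**: the coordinates of `embed g v` are those of `v`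
together with two zeros. [folklore] -/
theorem isPrimitive_embed_iff (v : Fin g ⊕ Fin g → ℤ) : IsPrimitive (embed g v) ↔ IsPrimitive v := by
  constructor
  · intro h d hd
    refine h d fun i => ?_
    rcases i with i | i <;> induction i using Fin.lastCases
    · simp
    · simpa using hd (Sum.inl _)
    · simp
    · simpa using hd (Sum.inr _)
  · intro h d hd
    refine h d fun i => ?_
    rcases i with j | j
    · simpa using hd (Sum.inl j.castSucc)
    · simpa using hd (Sum.inr j.castSucc)

/-- The classes of the stabilised word are primitive or zero as soon as the old ones are.
[folklore] -/
theorem zero_or_isPrimitive_stabBlock_append (c : Fin g ⊕ Fin g → ℤ) (l : IntWord g)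
    (hl : ∀ x ∈ l, x.1 = 0 ∨ IsPrimitive x.1) :
    ∀ x ∈ stabBlock g c ++ mapWord (embed g) l, x.1 = 0 ∨ IsPrimitive x.1 := by
  intro x hx
  rw [List.mem_append] at hx
  rcases hx with hx | hx
  · simp only [stabBlock, List.mem_cons, List.not_mem_nil, or_false] at hx
    rcases hx with rfl | rfl | rfl | rfl
    · exact Or.inr (isPrimitive_newE_add_embed c)
    · exact Or.inr isPrimitive_newF
    · exact Or.inr isPrimitive_newF
    · exact Or.inr (isPrimitive_newE_add_embed c)
  · simp only [mapWord, List.mem_map] at hx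
    obtain ⟨y, hy, rfl⟩ := hx
    rcases hl y hy with h0 | hp
    · exact Or.inl (by rw [h0, embed_zero])
    · exact Or.inr ((isPrimitive_embed_iff y.1).2 hp)

end StabBlockMoves

/-! ## Registered helper -/

open StabBlockMoves in
/-- **Registered helper `helper_hurwitzSteps_natBlock_stabBlock` (sub-goal of `stub_STgeo`, N3
bookkeeping, wave 6, lead c5): the natural front stabilisation block `(a,+)(a,−)(b,+)(b,−)`,
`a = newE g + embed g c`, `b = newF g`, followed by the embedded old word, is carried to the
registered `stabBlock g c ++ mapWord (embed g) l` by two signed Hurwitz moves at genus `g + 1`.**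
With the landed (HS) reduction this converts the natural stabilised fibred model of the N3 design
into the registered one. [cite: Baykur2006, Lemma 1] -/
theorem helper_hurwitzSteps_natBlock_stabBlock : ∀ (g : ℕ) (c : Fin g ⊕ Fin g → ℤ) (l : Literature.GroupTheory.CombinatorialGroupTheory.SignedHurwitz.IntWord g), ∃ l₁ : Literature.GroupTheory.CombinatorialGroupTheory.SignedHurwitz.IntWord (g + 1), Literature.GroupTheory.CombinatorialGroupTheory.SignedHurwitz.HurwitzStep (Literature.GroupTheory.CombinatorialGroupTheory.SignedHurwitz.stdSymp ℤ (g + 1)) ((Literature.GroupTheory.CombinatorialGroupTheory.SignedHurwitz.newE g + Literature.GroupTheory.CombinatorialGroupTheory.SignedHurwitz.embed g c, true) :: (Literature.GroupTheory.CombinatorialGroupTheory.SignedHurwitz.newE g + Literature.GroupTheory.CombinatorialGroupTheory.SignedHurwitz.embed g c, false) :: (Literature.GroupTheory.CombinatorialGroupTheory.SignedHurwitz.newF g, true) :: (Literature.GroupTheory.CombinatorialGroupTheory.SignedHurwitz.newF g, false) :: Literature.GroupTheory.CombinatorialGroupTheory.SignedHurwitz.mapWord (Literature.GroupTheory.CombinatorialGroupTheory.SignedHurwitz.embed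 g) l) l₁ ∧ Literature.GroupTheory.CombinatorialGroupTheory.SignedHurwitz.HurwitzStep (Literature.GroupTheory.CombinatorialGroupTheory.SignedHurwitz.stdSymp ℤ (g + 1)) l₁ (Literature.GroupTheory.CombinatorialGroupTheory.SignedHurwitz.stabBlock g c ++ Literature.GroupTheory.CombinatorialGroupTheory.SignedHurwitz.mapWord (Literature.GroupTheory.CombinatorialGroupTheory.SignedHurwitz.embed g) l) :=
  fun _ c l => hurwitzSteps_natBlock_stabBlock_front c l

end Summit.SmoothPoincare4.SmoothPoincare4.Theorems.AcyclicBisectionExists.ModpBraidOrbits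

end
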